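import Summits.Ventures.CertifiedArithmetic.LowPrec.SREnvelopes
import Mathlib.Probability.Moments.SubGaussian
import HarnessLib

/-!
# Stochastic rounding into a finite format: the exponential (Azuma–Hoeffding) envelope

HONEST FRAMING: certified error envelopes and provably optimal rounding/accumulation schemes for
low-precision formats under stated cost models; every table by two implementations; no hardware or
vendor claims.

`SREnvelopes` bounds the deviation of the dependent SR summation chain `ŝₖ₊₁ = SR(ŝₖ + xₖ)` by
Bienaymé–Chebyshev (`n G²/(4t²)`).  Here, over `K = ℝ`, we prove the exponential tail that is the
finite-format, absolute-error form of the martingale bound of [ConnollyHighamMary2021, Thm 4.6/4.8]: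

* `two_point_hoeffding` — Hoeffding's lemma for a two-point law (from Mathlib's
  `hasSubgaussianMGF_of_mem_Icc_of_integral_eq_zero` applied to the measure `p δ_a + (1−p) δ_b`);
* `step_exp_le` — one SR step: `E[e^{t(SR(c) − c̄)}] ≤ e^{t² G²/8}` when the candidate gap is `≤ G`;
* `accExp_exp_le` — the chain: under `NoSat ∧ GapLE G`, `E[e^{t(ŝₙ − s − ∑xₖ)}] ≤ e^{n t² G²/8}` for
  every real `t` (a supermartingale recursion over the outcome tree; no independence);
* `prob_dev_ge_le_exp` — `P(|ŝₙ − s − ∑ₖ xₖ| ≥ t) ≤ 2 e^{−2t²/(n G²)}`, i.e. deviation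
  `≥ λ (G/2) √n` has probability `≤ 2e^{−λ²/2}` — the `√n u → λ√n u` rule of CHM with `uM` replaced by
  the path-wise half-gap `G/2`, valid through subnormals; the only hypotheses are `NoSat` and `GapLE G`.
-/

namespace Summit.Ventures.CertifiedArithmetic.LowPrec.SR

open MeasureTheory ProbabilityTheory Real Finset
open Literature.ComputerArithmetic.ConnollyHighamMary2021

/-! ### Hoeffding's lemma for a two-point law -/

/-- The two-point law `p δ_a + (1 − p) δ_b` as a measure on `ℝ`. -/
noncomputable def twoPoint (p a b : ℝ) : Measure ℝ :=
  ENNReal.ofReal p • Measure.dirac a + ENNReal.ofReal (1 - p) • Measure.dirac b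

/-- `twoPoint p a b` is a probability measure for `0 ≤ p ≤ 1`. -/
theorem isProbabilityMeasure_twoPoint {p : ℝ} (hp0 : 0 ≤ p) (hp1 : p ≤ 1) (a b : ℝ) :
    IsProbabilityMeasure (twoPoint p a b) := by
  refine ⟨?_⟩
  simp only [twoPoint, Measure.coe_add, Measure.coe_smul, Pi.add_apply, Pi.smul_apply,
    measure_univ, smul_eq_mul, mul_one]
  rw [← ENNReal.ofReal_add hp0 (sub_nonneg.mpr hp1)]
  simp

/-- Integration against the two-point law. -/
theorem integral_twoPoint {p : ℝ} (hp0 : 0 ≤ p) (hp1 : p ≤ 1) (a b : ℝ) (f : ℝ → ℝ) :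
    ∫ x, f x ∂twoPoint p a b = p * f a + (1 - p) * f b := by
  unfold twoPoint
  have ia : Integrable f (ENNReal.ofReal p • Measure.dirac a) :=
    ((integrable_const (f a)).congr (ae_eq_dirac f).symm).smul_measure ENNReal.ofReal_ne_top
  have ib : Integrable f (ENNReal.ofReal (1 - p) • Measure.dirac b) :=
    ((integrable_const (f b)).congr (ae_eq_dirac f).symm).smul_measure ENNReal.ofReal_ne_top
  rw [integral_add_measure ia ib, integral_smul_measure, integral_smul_measure, integral_dirac,
    integral_dirac, ENNReal.toReal_ofReal hp0, ENNReal.toReal_ofReal (sub_nonneg.mpr hp1),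
    smul_eq_mul, smul_eq_mul]

/-- Almost every point of the two-point law is `a` or `b`. -/
theorem ae_twoPoint_mem {p : ℝ} (a b : ℝ) {P : ℝ → Prop} (ha : P a) (hb : P b) :
    ∀ᵐ x ∂twoPoint p a b, P x := by
  unfold twoPoint
  rw [ae_add_measure_iff]
  constructor
  · refine Measure.ae_smul_measure ?_ _
    rw [ae_dirac_eq]; exact Filter.eventually_pure.mpr ha
  · refine Measure.ae_smul_measure ?_ _
    rw [ae_dirac_eq]; exact Filter.eventually_pure.mpr hb

/-- **Hoeffding's lemma, two-point case.** For `0 ≤ p ≤ 1`, `b ≤ a` and the mean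
`m = p a + (1 − p) b`: `p e^{t(a−m)} + (1−p) e^{t(b−m)} ≤ e^{t²(a−b)²/8}` for every real `t`. -/
theorem two_point_hoeffding {p a b : ℝ} (hp0 : 0 ≤ p) (hp1 : p ≤ 1) (hba : b ≤ a) (t : ℝ) :
    p * exp (t * (a - (p * a + (1 - p) * b))) + (1 - p) * exp (t * (b - (p * a + (1 - p) * b)))
      ≤ exp (t ^ 2 * (a - b) ^ 2 / 8) := by
  set m := p * a + (1 - p) * b with hm
  haveI := isProbabilityMeasure_twoPoint hp0 hp1 a b
  have hX : AEMeasurable (fun x : ℝ => x - m) (twoPoint p a b) :=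
    (measurable_id.sub_const m).aemeasurable
  have hmem : ∀ᵐ x ∂twoPoint p a b, (fun x : ℝ => x - m) x ∈ Set.Icc (b - m) (a - m) :=
    ae_twoPoint_mem a b ⟨by linarith, le_rfl⟩ ⟨le_rfl, by linarith⟩
  have h0 : ∫ x, (fun x : ℝ => x - m) x ∂twoPoint p a b = 0 := by
    rw [integral_twoPoint hp0 hp1]; rw [hm]; ring
  have hsg := hasSubgaussianMGF_of_mem_Icc_of_integral_eq_zero hX hmem h0
  have h := hsg.mgf_le t
  simp only [mgf] at h
  rw [integral_twoPoint hp0 hp1] at h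
  have hs : ((‖(a - m) - (b - m)‖₊ / 2 : NNReal) : ℝ) = (a - b) / 2 := by
    rw [NNReal.coe_div, coe_nnnorm, Real.norm_eq_abs, show (a - m) - (b - m) = a - b by ring,
      abs_of_nonneg (sub_nonneg.mpr hba)]
    norm_num
  calc p * exp (t * (a - m)) + (1 - p) * exp (t * (b - m))
      ≤ exp ((((‖(a - m) - (b - m)‖₊ / 2) ^ 2 : NNReal) : ℝ) * t ^ 2 / 2) := h
    _ = exp (t ^ 2 * (a - b) ^ 2 / 8) := by rw [NNReal.coe_pow, hs]; ring_nf

/-! ### One SR step and the chain -/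

/-- **One step.** If the candidate gap of `c̄` is `≤ G` then `E[e^{t(SR(c) − c̄)}] ≤ e^{t² G²/8}`. -/
theorem step_exp_le (F : Finset ℝ) (c t : ℝ) {G : ℝ}
    (hg : roundUp F (clamp F c) - roundDown F (clamp F c) ≤ G) :
    step F c (fun v => exp (t * (v - clamp F c))) ≤ exp (t ^ 2 * G ^ 2 / 8) := by
  have hmean : pUp F c * roundUp F (clamp F c) + (1 - pUp F c) * roundDown F (clamp F c)
      = clamp F c := step_id F c
  have h := two_point_hoeffding (pUp_nonneg F c) (pUp_le_one F c)
    (roundDown_le_roundUp F (clamp F c)) t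
  rw [hmean] at h
  have h' : step F c (fun v => exp (t * (v - clamp F c)))
      ≤ exp (t ^ 2 * (roundUp F (clamp F c) - roundDown F (clamp F c)) ^ 2 / 8) := h
  refine h'.trans ?_
  have h0 : 0 ≤ roundUp F (clamp F c) - roundDown F (clamp F c) :=
    sub_nonneg.mpr (roundDown_le_roundUp F (clamp F c))
  have h1 : (roundUp F (clamp F c) - roundDown F (clamp F c)) ^ 2 ≤ G ^ 2 := by
    rw [sq, sq]; exact mul_self_le_mul_self h0 hg
  exact exp_le_exp.mpr (by nlinarith [sq_nonneg t])

/-- monotonicity of one step through its two leaves only -/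
theorem step_mono_of (F : Finset ℝ) (c : ℝ) {f g : ℝ → ℝ} (hu : f (up F c) ≤ g (up F c))
    (hd : f (dn F c) ≤ g (dn F c)) : step F c f ≤ step F c g := by
  unfold step
  have hp := pUp_nonneg F c
  have hq : 0 ≤ 1 - pUp F c := sub_nonneg.mpr (pUp_le_one F c)
  nlinarith [mul_le_mul_of_nonneg_left hu hp, mul_le_mul_of_nonneg_left hd hq]

/-- **The chain (moment generating function).** Under `NoSat ∧ GapLE G`, for every real `t`,
`E_s[e^{t(ŝₙ − s − ∑ₖ xₖ)}] ≤ e^{n t² G²/8}` — the increments are a bounded martingale-difference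
sequence along the outcome tree and Hoeffding's lemma is applied conditionally at every node. -/
theorem accExp_exp_le (F : Finset ℝ) (G t : ℝ) :
    ∀ (n : ℕ) (x : ℕ → ℝ) (s : ℝ), NoSat F x n s → GapLE F G x n s →
      accExp F x n (fun v => exp (t * (v - (s + ∑ i ∈ range n, x i)))) s
        ≤ exp (n * (t ^ 2 * G ^ 2 / 8)) := by
  intro n
  induction n with
  | zero => intro x s _ _; simp [accExp]
  | succ n ih =>
      intro x s h hg
      obtain ⟨hc, hu, hd⟩ := h
      obtain ⟨hgap, hgu, hgd⟩ := hg
      simp only [accExp]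
      rw [sum_range_succ' x n]
      set S := ∑ i ∈ range n, x (i + 1) with hS
      set c := s + x 0 with hc_def
      set B := exp (n * (t ^ 2 * G ^ 2 / 8)) with hB
      have hcl : clamp F c = c := clamp_eq_self hc
      -- at a leaf `ℓ`, the observable factors as `e^{t(ℓ - c)} · e^{t(v − (ℓ + S))}`
      have leaf : ∀ ℓ, NoSat F (fun i => x (i + 1)) n ℓ → GapLE F G (fun i => x (i + 1)) n ℓ →
          accExp F (fun i => x (i + 1)) n (fun v => exp (t * (v - (s + (S + x 0))))) ℓ
            ≤ exp (t * (ℓ - c)) * B := by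
        intro ℓ h1 h2
        have hf : (fun v => exp (t * (v - (s + (S + x 0)))))
            = fun v => exp (t * (ℓ - c)) * exp (t * (v - (ℓ + ∑ i ∈ range n, x (i + 1)))) := by
          funext v; rw [← exp_add, ← hS, hc_def]; ring_nf
        rw [hf, accExp_mul_left]
        exact mul_le_mul_of_nonneg_left (ih _ _ h1 h2) (exp_pos _).le
      calc step F c (accExp F (fun i => x (i + 1)) n (fun v => exp (t * (v - (s + (S + x 0))))))
          ≤ step F c (fun ℓ => B * exp (t * (ℓ - clamp F c))) := by
            refine step_mono_of F c ?_ ?_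
            · rw [hcl, mul_comm]; exact leaf _ hu hgu
            · rw [hcl, mul_comm]; exact leaf _ hd hgd
        _ = B * step F c (fun ℓ => exp (t * (ℓ - clamp F c))) := step_mul_left F c B _
        _ ≤ B * exp (t ^ 2 * G ^ 2 / 8) :=
            mul_le_mul_of_nonneg_left (step_exp_le F c t hgap) (exp_pos _).le
        _ = exp (↑(n + 1) * (t ^ 2 * G ^ 2 / 8)) := by
            rw [hB, ← exp_add]; push_cast; ring_nf

/-! ### The exponential tail -/

/-- upper-deviation indicator `𝟙{t ≤ v − a}` -/
noncomputable def upDevInd (t a v : ℝ) : ℝ := if t ≤ v - a then 1 else 0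

/-- lower-deviation indicator `𝟙{t ≤ a − v}` -/
noncomputable def dnDevInd (t a v : ℝ) : ℝ := if t ≤ a - v then 1 else 0

/-- `𝟙{t ≤ |v − a|} ≤ 𝟙{t ≤ v − a} + 𝟙{t ≤ a − v}`. -/
theorem devInd_le_up_add_dn (t a v : ℝ) : devInd t a v ≤ upDevInd t a v + dnDevInd t a v := by
  unfold devInd upDevInd dnDevInd
  by_cases h : t ≤ |v - a|
  · rw [if_pos h]
    rcases le_abs'.mp h with h1 | h1
    · have : t ≤ a - v := by linarith
      rw [if_pos this]; split_ifs <;> norm_num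
    · rw [if_pos h1]; split_ifs <;> norm_num
  · rw [if_neg h]; split_ifs <;> norm_num

/-- Chernoff's pointwise inequality `𝟙{t ≤ v − a} ≤ e^{θ(v − a) − θ t}` for `θ ≥ 0`. -/
theorem upDevInd_le_exp (t a v : ℝ) {θ : ℝ} (hθ : 0 ≤ θ) :
    upDevInd t a v ≤ exp (-(θ * t)) * exp (θ * (v - a)) := by
  unfold upDevInd
  split_ifs with h
  · rw [← exp_add]
    have : 0 ≤ -(θ * t) + θ * (v - a) := by nlinarith [mul_le_mul_of_nonneg_left h hθ]
    exact one_le_exp this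
  · positivity

/-- The same for the lower deviation: `𝟙{t ≤ a − v} ≤ e^{−θt} e^{(−θ)(v − a)}` for `θ ≥ 0`. -/
theorem dnDevInd_le_exp (t a v : ℝ) {θ : ℝ} (hθ : 0 ≤ θ) :
    dnDevInd t a v ≤ exp (-(θ * t)) * exp (-θ * (v - a)) := by
  unfold dnDevInd
  split_ifs with h
  · rw [← exp_add]
    have : 0 ≤ -(θ * t) + -θ * (v - a) := by nlinarith [mul_le_mul_of_nonneg_left h hθ]
    exact one_le_exp this
  · positivity

/-- **One-sided exponential tails.** Under `NoSat ∧ GapLE G`, for every `θ ≥ 0`: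
`P(ŝₙ − s − ∑xₖ ≥ t) ≤ e^{−θt + nθ²G²/8}` and the same for the lower tail. -/
theorem prob_updev_le (F : Finset ℝ) (G : ℝ) (x : ℕ → ℝ) (n : ℕ) (s : ℝ) (h : NoSat F x n s)
    (hg : GapLE F G x n s) (t : ℝ) {θ : ℝ} (hθ : 0 ≤ θ) :
    accExp F x n (upDevInd t (s + ∑ i ∈ range n, x i)) s
        ≤ exp (-(θ * t)) * exp (n * (θ ^ 2 * G ^ 2 / 8)) ∧
      accExp F x n (dnDevInd t (s + ∑ i ∈ range n, x i)) s
        ≤ exp (-(θ * t)) * exp (n * (θ ^ 2 * G ^ 2 / 8)) := by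
  constructor
  · calc accExp F x n (upDevInd t (s + ∑ i ∈ range n, x i)) s
        ≤ accExp F x n (fun v => exp (-(θ * t)) * exp (θ * (v - (s + ∑ i ∈ range n, x i)))) s :=
          accExp_mono F x n (fun v => upDevInd_le_exp t _ v hθ) s
      _ ≤ exp (-(θ * t)) * exp (n * (θ ^ 2 * G ^ 2 / 8)) := by
          rw [accExp_mul_left]
          exact mul_le_mul_of_nonneg_left (accExp_exp_le F G θ n x s h hg) (exp_pos _).le
  · calc accExp F x n (dnDevInd t (s + ∑ i ∈ range n, x i)) s
        ≤ accExp F x n (fun v => exp (-(θ * t)) * exp (-θ * (v - (s + ∑ i ∈ range n, x i)))) s :=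
          accExp_mono F x n (fun v => dnDevInd_le_exp t _ v hθ) s
      _ ≤ exp (-(θ * t)) * exp (n * (θ ^ 2 * G ^ 2 / 8)) := by
          rw [accExp_mul_left]
          refine mul_le_mul_of_nonneg_left ?_ (exp_pos _).le
          have := accExp_exp_le F G (-θ) n x s h hg
          rwa [neg_sq] at this

/-- **Exponential (Azuma–Hoeffding) envelope for SR summation in a finite format.** If no branch
saturates and every candidate gap is `≤ G` (`0 ≤ G`), then for every `t > 0`
`P(|ŝₙ − s − ∑ₖ xₖ| ≥ t) ≤ 2 exp(−2t²/(n G²))`; with `t = λ (G/2) √n` the bound is `2e^{−λ²/2}`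
([ConnollyHighamMary2021, Thm 4.6] shape, absolute errors, no underflow hypothesis). For `n G² = 0` the
right-hand side is `2` (Lean's `x/0 = 0`) and the statement is trivially true. -/
theorem prob_dev_ge_le_exp (F : Finset ℝ) (G : ℝ) (x : ℕ → ℝ) (n : ℕ) (s : ℝ) (h : NoSat F x n s)
    (hg : GapLE F G x n s) (t : ℝ) (ht : 0 < t) :
    accExp F x n (devInd t (s + ∑ i ∈ range n, x i)) s ≤ 2 * exp (-2 * t ^ 2 / (n * G ^ 2)) := by
  have hsplit : accExp F x n (devInd t (s + ∑ i ∈ range n, x i)) s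
      ≤ accExp F x n (upDevInd t (s + ∑ i ∈ range n, x i)) s
        + accExp F x n (dnDevInd t (s + ∑ i ∈ range n, x i)) s := by
    rw [← accExp_add]; exact accExp_mono F x n (fun v => devInd_le_up_add_dn t _ v) s
  by_cases hD : n * G ^ 2 = 0
  · -- degenerate: the bound is 2, and each one-sided probability is ≤ 1 (θ = 0)
    have h1 := prob_updev_le F G x n s h hg t le_rfl
    simp only [zero_mul, neg_zero, exp_zero, one_mul, ne_eq, zero_pow, OfNat.ofNat_ne_zero,
      not_false_eq_true, zero_div, mul_zero] at h1
    rw [hD, div_zero, exp_zero, mul_one]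
    linarith [h1.1, h1.2]
  · have hpos : 0 < n * G ^ 2 := lt_of_le_of_ne (by positivity) (Ne.symm hD)
    set θ := 4 * t / (n * G ^ 2) with hθ
    have hθ0 : 0 ≤ θ := by positivity
    have h1 := prob_updev_le F G x n s h hg t hθ0
    have key : exp (-(θ * t)) * exp (n * (θ ^ 2 * G ^ 2 / 8)) = exp (-2 * t ^ 2 / (n * G ^ 2)) := by
      rw [← exp_add]; congr 1
      rw [hθ]; field_simp; ring
    rw [key] at h1
    linarith [h1.1, h1.2]

/-- The **λ-form**: deviation at least `λ (G/2) √n` has probability at most `2 e^{−λ²/2}`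
(`0 < λ`, `0 < G`, `0 < n`). -/
theorem prob_dev_ge_lambda_le (F : Finset ℝ) {G : ℝ} (hG : 0 < G) (x : ℕ → ℝ) {n : ℕ} (hn : 0 < n)
    (s : ℝ) (h : NoSat F x n s) (hg : GapLE F G x n s) {lam : ℝ} (hlam : 0 < lam) :
    accExp F x n (devInd (lam * (G / 2) * Real.sqrt n) (s + ∑ i ∈ range n, x i)) s
      ≤ 2 * exp (-lam ^ 2 / 2) := by
  have hn' : (0 : ℝ) < n := by exact_mod_cast hn
  have ht : 0 < lam * (G / 2) * Real.sqrt n := by positivity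
  refine (prob_dev_ge_le_exp F G x n s h hg _ ht).trans (le_of_eq ?_)
  have hs : Real.sqrt (n : ℝ) ^ 2 = n := Real.sq_sqrt hn'.le
  have : -2 * (lam * (G / 2) * Real.sqrt n) ^ 2 / (n * G ^ 2) = -lam ^ 2 / 2 := by
    rw [mul_pow, mul_pow, hs]; field_simp
  rw [this]

end Summit.Ventures.CertifiedArithmetic.LowPrec.SR
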